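import Mathlib
import Summits.Ventures.PercRepro2.Defs
import Summits.Ventures.PercRepro2.Independence
import Summits.Ventures.PercRepro2.Harris
import Summits.Ventures.PercRepro2.ZCTwoEdge

/-!
# (ZC) when `a₃` has no neighbour outside `{a₁, o}` — the mirror two-edge theorem (Theorem C)
(blind cell PercRepro2, mine-a g23; MINE-A.md §70.1)

The four-mark inequality (ZC) of MINE-A.md §66,
`P(D) · Cov(U, eL) ≥ P(B) · Cov(U, e¬L)`  (`e = {a₃ ∈ C₁}`, `L = {o ∈ C₁}`, `U = {C₁ ∈ 𝒰}`,
`B = [a₁ | a₃o]`, `D = [a₁ | a₃ | o]`), is proved here for every graph in which the mark `a₃` is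
joined to the rest only through the two edges `f₁ = a₃a₁` and `f₂ = a₃o` — the mirror of
Theorem A (`zc_two_edge`, where the root `a₁` was the degree-two vertex).

The statement is abstract: `A'` is the event `{a₁ ↔ o}` of the graph `G − a₃` (it ignores `f₁`,
`f₂`), and `X₀ ⊆ X₁ ⊆ X₂` are the events `{C(a₁) ∈ 𝒰}`, `{C(a₁) ∪ {a₃} ∈ 𝒰}`,
`{C(a₁) ∪ C(o) ∪ {a₃} ∈ 𝒰}` of `G − a₃` (ignoring `f₁`, `f₂`; `X₂` increasing; on `A'` the
clusters of `a₁` and `o` coincide, so `X₁ ∩ A' = X₂ ∩ A'`).  In that graph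
`e = {f₁ open} ∪ ({f₂ open} ∩ A')`, `L = A' ∪ {f₁, f₂ open}`, `{a₃ ↔ o} = {f₂ open} ∪ ({f₁ open} ∩ A')`,
and `U = ({f₁, f₂ open} ∩ X₂) ∪ (e ∩ {f₁, f₂ open}ᶜ ∩ X₁) ∪ (eᶜ ∩ X₀)` — nothing else about the
graph is used.

The proof: expand every probability over the four states of `(f₁, f₂)` (`prob_two_pin`), so that
everything is a polynomial in `p f₁`, `p f₂`, `g = P(A')`, `a = P(X₂ ∩ A')`, `z = P(X₂ ∩ A'ᶜ)`,
`b = P(X₁ ∩ A'ᶜ)`, `c = P(X₀ ∩ A')`, `d = P(X₀ ∩ A'ᶜ)`; ONE Harris inequality in `G − a₃`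
(`X₂` and `A'` increasing) gives `(1 − g) a ≥ g z`; monotonicity gives `d ≤ b ≤ z`, `c ≤ a`; and
the polynomial identity
`(ZC) = (1−p₁)(1−p₂)(1−g) · { π₂ [(1−g)a − gz] + π₂ g [(a + z) − P(U)] + p₁p₂ (z − b) }`
(`π₂ = p₁ + p₂ − p₁p₂`, `(a + z) − P(U) = p₁(1−p₂)(z−b) + (1−p₁)p₂(z−d) + (1−p₁)(1−p₂)(a+z−c−d)`)
exhibits the slack as a sum of products of nonnegative factors.  One seat; every identity twinned
in exact rational arithmetic (data/mine-a/g23/codes/twin_cd.py, 350 cells).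
-/

namespace Summit.Ventures.PercRepro2

section A3TwoEdgeTheorem

variable {E : Type*} [Fintype E] [DecidableEq E] {R : Type*} [CommRing R] [LinearOrder R]
  [IsStrictOrderedRing R]

/-- The algebraic core of Theorem C: with `p₁ = p f₁`, `p₂ = p f₂`, `g = P(A')`, `a = P(X₂ ∩ A')`,
`z = P(X₂ ∩ A'ᶜ)`, `b = P(X₁ ∩ A'ᶜ)`, `c = P(X₀ ∩ A')`, `d = P(X₀ ∩ A'ᶜ)`, the (ZC) expression
minus the explicit bound `(1−p₁)(1−p₂)(1−g)·[π₂((1−g)a − gz) + p₁p₂(z − b)]` equals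
`(1−p₁)(1−p₂)(1−g)·π₂·g·[(a + z) − P(U)]`, a product of nonnegative factors. -/
lemma zc_a3_two_edge_alg (p₁ p₂ g a z b c d : R) (hp1 : 0 ≤ p₁) (hp1' : p₁ ≤ 1) (hp2 : 0 ≤ p₂)
    (hp2' : p₂ ≤ 1) (hg0 : 0 ≤ g) (hg1 : g ≤ 1) (hzb : b ≤ z) (hdb : d ≤ b) (hca : c ≤ a) :
    (1 - p₁) * (1 - p₂) * (1 - g) *
      (p₁ * p₂ * (a + z) + p₁ * (1 - p₂) * a + (1 - p₁) * p₂ * a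
        - (p₁ * p₂ * (a + z) + p₁ * (1 - p₂) * (a + b) + (1 - p₁) * p₂ * (a + d)
            + (1 - p₁) * (1 - p₂) * (c + d))
          * (p₁ * p₂ + p₁ * (1 - p₂) * g + (1 - p₁) * p₂ * g))
      - (1 - p₁) * p₂ * (1 - g) *
        (p₁ * (1 - p₂) * b
          - (p₁ * p₂ * (a + z) + p₁ * (1 - p₂) * (a + b) + (1 - p₁) * p₂ * (a + d)
              + (1 - p₁) * (1 - p₂) * (c + d))
            * (p₁ * (1 - p₂) * (1 - g)))
      ≥ (1 - p₁) * (1 - p₂) * (1 - g) *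
          ((p₁ + p₂ - p₁ * p₂) * ((1 - g) * a - g * z) + p₁ * p₂ * (z - b)) := by
  have h1p : 0 ≤ 1 - p₁ := sub_nonneg.2 hp1'
  have h1q : 0 ≤ 1 - p₂ := sub_nonneg.2 hp2'
  have h1g : 0 ≤ 1 - g := sub_nonneg.2 hg1
  have hπ₂ : 0 ≤ p₁ + p₂ - p₁ * p₂ := by
    have := mul_nonneg hp2 h1p; linarith
  have hdz : d ≤ z := le_trans hdb hzb
  have hmono : 0 ≤ p₁ * (1 - p₂) * (z - b) + (1 - p₁) * p₂ * (z - d)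
      + (1 - p₁) * (1 - p₂) * ((a - c) + (z - d)) :=
    add_nonneg (add_nonneg (mul_nonneg (mul_nonneg hp1 h1q) (sub_nonneg.2 hzb))
      (mul_nonneg (mul_nonneg h1p hp2) (sub_nonneg.2 hdz)))
      (mul_nonneg (mul_nonneg h1p h1q) (add_nonneg (sub_nonneg.2 hca) (sub_nonneg.2 hdz)))
  have hnn : 0 ≤ (1 - p₁) * (1 - p₂) * (1 - g) * (p₁ + p₂ - p₁ * p₂) * g *
      (p₁ * (1 - p₂) * (z - b) + (1 - p₁) * p₂ * (z - d)
        + (1 - p₁) * (1 - p₂) * ((a - c) + (z - d))) :=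
    mul_nonneg (mul_nonneg (mul_nonneg (mul_nonneg (mul_nonneg h1p h1q) h1g) hπ₂) hg0) hmono
  have key : (1 - p₁) * (1 - p₂) * (1 - g) *
      (p₁ * p₂ * (a + z) + p₁ * (1 - p₂) * a + (1 - p₁) * p₂ * a
        - (p₁ * p₂ * (a + z) + p₁ * (1 - p₂) * (a + b) + (1 - p₁) * p₂ * (a + d)
            + (1 - p₁) * (1 - p₂) * (c + d))
          * (p₁ * p₂ + p₁ * (1 - p₂) * g + (1 - p₁) * p₂ * g))
      - (1 - p₁) * p₂ * (1 - g) *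
        (p₁ * (1 - p₂) * b
          - (p₁ * p₂ * (a + z) + p₁ * (1 - p₂) * (a + b) + (1 - p₁) * p₂ * (a + d)
              + (1 - p₁) * (1 - p₂) * (c + d))
            * (p₁ * (1 - p₂) * (1 - g)))
      - (1 - p₁) * (1 - p₂) * (1 - g) *
          ((p₁ + p₂ - p₁ * p₂) * ((1 - g) * a - g * z) + p₁ * p₂ * (z - b))
      = (1 - p₁) * (1 - p₂) * (1 - g) * (p₁ + p₂ - p₁ * p₂) * g *
      (p₁ * (1 - p₂) * (z - b) + (1 - p₁) * p₂ * (z - d)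
        + (1 - p₁) * (1 - p₂) * ((a - c) + (z - d))) := by ring
  linarith [key, hnn]

/-- **Theorem C (MINE-A.md §70.1)** — (ZC) for every graph in which the mark `a₃` is joined to
the rest only by the two edges `f₁ = a₃a₁` (weight `p f₁`) and `f₂ = a₃o` (weight `p f₂`), for
every cluster up-set: with `e`, `L`, `U`, `γ` as above and `B = eᶜ ∩ Lᶜ ∩ γ`, `D = eᶜ ∩ Lᶜ ∩ γᶜ`,
  `P(D) · (P(U ∩ e ∩ L) − P(U) P(e ∩ L)) − P(B) · (P(U ∩ e ∩ Lᶜ) − P(U) P(e ∩ Lᶜ))`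
  `≥ (1 − p f₁)(1 − p f₂)(1 − g) · [π₂ · ((1 − g) P(X₂ ∩ A') − g P(X₂ ∩ A'ᶜ)) + p f₁ · p f₂ · (P(X₂ ∩ A'ᶜ) − P(X₁ ∩ A'ᶜ))] ≥ 0`,
`g = P(A')`, `π₂ = p f₁ + p f₂ − p f₁ · p f₂`.
Inputs: `A'`, `X₀`, `X₁`, `X₂` ignore `f₁`, `f₂` (membership is invariant under forcing them);
`X₁ ∩ A' = X₂ ∩ A'` (on `a₁ ↔ o` the two glued clusters coincide); `X₀ ⊆ X₁ ⊆ X₂` (monotonicity of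
the up-set).  This exact lower bound needs no Harris inequality; the sign of the bound (hence of
(ZC)) is the ONE Harris inequality `(1 − g) P(X₂ ∩ A') ≥ g P(X₂ ∩ A'ᶜ)` between the increasing
events `X₂` and `A'` of `G − a₃` — `zc_a3_two_edge_nonneg`. -/
theorem zc_a3_two_edge {p : E → R} (hp : IsProbVec p) {f₁ f₂ : E} (hf : f₁ ≠ f₂)
    {A' X₀ X₁ X₂ : Set (Config E)}
    (hA' : ∀ (ω : Config E) (b₁ b₂ : Bool),
      Function.update (Function.update ω f₁ b₁) f₂ b₂ ∈ A' ↔ ω ∈ A')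
    (hX₀ : ∀ (ω : Config E) (b₁ b₂ : Bool),
      Function.update (Function.update ω f₁ b₁) f₂ b₂ ∈ X₀ ↔ ω ∈ X₀)
    (hX₁ : ∀ (ω : Config E) (b₁ b₂ : Bool),
      Function.update (Function.update ω f₁ b₁) f₂ b₂ ∈ X₁ ↔ ω ∈ X₁)
    (hX₂ : ∀ (ω : Config E) (b₁ b₂ : Bool),
      Function.update (Function.update ω f₁ b₁) f₂ b₂ ∈ X₂ ↔ ω ∈ X₂)
    (h12 : X₁ ∩ A' = X₂ ∩ A') (h01 : X₀ ⊆ X₁) (h12s : X₁ ⊆ X₂) :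
    let e := openEdge f₁ ∪ (openEdge f₂ ∩ A')
    let L := A' ∪ (openEdge f₁ ∩ openEdge f₂)
    let U := (openEdge f₁ ∩ openEdge f₂ ∩ X₂) ∪ (e ∩ (openEdge f₁ ∩ openEdge f₂)ᶜ ∩ X₁)
      ∪ (eᶜ ∩ X₀)
    let γ := openEdge f₂ ∪ (openEdge f₁ ∩ A')
    prob p (eᶜ ∩ Lᶜ ∩ γᶜ) * (prob p (U ∩ (e ∩ L)) - prob p U * prob p (e ∩ L))
      - prob p (eᶜ ∩ Lᶜ ∩ γ) * (prob p (U ∩ (e ∩ Lᶜ)) - prob p U * prob p (e ∩ Lᶜ))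
      ≥ (1 - p f₁) * (1 - p f₂) * (1 - prob p A') *
          ((p f₁ + p f₂ - p f₁ * p f₂)
              * ((1 - prob p A') * prob p (X₂ ∩ A') - prob p A' * prob p (X₂ ∩ A'ᶜ))
            + p f₁ * p f₂ * (prob p (X₂ ∩ A'ᶜ) - prob p (X₁ ∩ A'ᶜ))) := by
  intro e L U γ
  -- the forced events
  have hs1 := update2_fst hf
  -- closed forms of the seven probabilities
  set g := prob p A' with hg
  set a := prob p (X₂ ∩ A') with ha
  set z := prob p (X₂ ∩ A'ᶜ) with hz
  set b := prob p (X₁ ∩ A'ᶜ) with hb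
  set c := prob p (X₀ ∩ A') with hc
  set d := prob p (X₀ ∩ A'ᶜ) with hd
  have hX2 : prob p X₂ = a + z := (prob_inter_add_prob_inter_compl p X₂ A').symm
  have hX1 : prob p X₁ = a + b := by
    rw [← prob_inter_add_prob_inter_compl p X₁ A', h12]
  have hX0 : prob p X₀ = c + d := (prob_inter_add_prob_inter_compl p X₀ A').symm
  have hX1A : prob p (X₁ ∩ A') = a := by rw [h12]
  have hAc : prob p A'ᶜ = 1 - g := prob_compl p A'
  -- the mixed cell `(f₁ closed, f₂ open)`: `U = (A' ∩ X₁) ∪ (A'ᶜ ∩ X₀)`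
  have hmix : prob p ((A' ∩ X₁) ∪ (A'ᶜ ∩ X₀)) = a + d := by
    rw [← prob_inter_add_prob_inter_compl p ((A' ∩ X₁) ∪ (A'ᶜ ∩ X₀)) A']
    have e1 : ((A' ∩ X₁) ∪ (A'ᶜ ∩ X₀)) ∩ A' = X₁ ∩ A' := by
      ext ω; simp only [Set.mem_inter_iff, Set.mem_union, Set.mem_compl_iff]; tauto
    have e2 : ((A' ∩ X₁) ∪ (A'ᶜ ∩ X₀)) ∩ A'ᶜ = X₀ ∩ A'ᶜ := by
      ext ω; simp only [Set.mem_inter_iff, Set.mem_union, Set.mem_compl_iff]; tauto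
    rw [e1, e2, hX1A]
  have PeL : prob p (e ∩ L) = p f₁ * p f₂ + p f₁ * (1 - p f₂) * g + (1 - p f₁) * p f₂ * g := by
    rw [prob_two_pin p hf]
    have e11 : {ω | Function.update (Function.update ω f₁ true) f₂ true ∈ (e ∩ L)} = Set.univ := by
      ext ω; simp [e, L, hs1, hA']
    have e10 : {ω | Function.update (Function.update ω f₁ true) f₂ false ∈ (e ∩ L)} = A' := by
      ext ω; simp [e, L, hs1, hA']
    have e01 : {ω | Function.update (Function.update ω f₁ false) f₂ true ∈ (e ∩ L)} = A' := by
      ext ω; simp [e, L, hs1, hA']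
    have e00 : {ω | Function.update (Function.update ω f₁ false) f₂ false ∈ (e ∩ L)} = ∅ := by
      ext ω; simp [e, L, hs1, hA']
    rw [e11, e10, e01, e00, prob_univ, prob_empty]; ring
  have PUeL : prob p (U ∩ (e ∩ L)) = p f₁ * p f₂ * (a + z) + p f₁ * (1 - p f₂) * a
      + (1 - p f₁) * p f₂ * a := by
    rw [prob_two_pin p hf]
    have e11 : {ω | Function.update (Function.update ω f₁ true) f₂ true ∈ (U ∩ (e ∩ L))} = X₂ := by
      ext ω; simp [e, L, U, hs1, hA', hX₂]
    have e10 : {ω | Function.update (Function.update ω f₁ true) f₂ false ∈ (U ∩ (e ∩ L))} = X₁ ∩ A' := by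
      ext ω; simp [e, L, U, hs1, hA', hX₁]
    have e01 : {ω | Function.update (Function.update ω f₁ false) f₂ true ∈ (U ∩ (e ∩ L))} = X₁ ∩ A' := by
      ext ω; simp [e, L, U, hs1, hA', hX₁, hX₀]; tauto
    have e00 : {ω | Function.update (Function.update ω f₁ false) f₂ false ∈ (U ∩ (e ∩ L))} = ∅ := by
      ext ω; simp [e, L, U, hs1, hA']
    rw [e11, e10, e01, e00, prob_empty, hX2, hX1A]; ring
  have PenL : prob p (e ∩ Lᶜ) = p f₁ * (1 - p f₂) * (1 - g) := by
    rw [prob_two_pin p hf]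
    have e11 : {ω | Function.update (Function.update ω f₁ true) f₂ true ∈ (e ∩ Lᶜ)} = ∅ := by
      ext ω; simp [e, L, hs1]
    have e10 : {ω | Function.update (Function.update ω f₁ true) f₂ false ∈ (e ∩ Lᶜ)} = A'ᶜ := by
      ext ω; simp [e, L, hs1, hA']
    have e01 : {ω | Function.update (Function.update ω f₁ false) f₂ true ∈ (e ∩ Lᶜ)} = ∅ := by
      ext ω; simp [e, L, hs1, hA']
    have e00 : {ω | Function.update (Function.update ω f₁ false) f₂ false ∈ (e ∩ Lᶜ)} = ∅ := by
      ext ω; simp [e, L, hs1]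
    rw [e11, e10, e01, e00, prob_empty, hAc]; ring
  have PUenL : prob p (U ∩ (e ∩ Lᶜ)) = p f₁ * (1 - p f₂) * b := by
    rw [prob_two_pin p hf]
    have e11 : {ω | Function.update (Function.update ω f₁ true) f₂ true ∈ (U ∩ (e ∩ Lᶜ))} = ∅ := by
      ext ω; simp [e, L, U, hs1]
    have e10 : {ω | Function.update (Function.update ω f₁ true) f₂ false ∈ (U ∩ (e ∩ Lᶜ))} = X₁ ∩ A'ᶜ := by
      ext ω; simp [e, L, U, hs1, hA', hX₁]
    have e01 : {ω | Function.update (Function.update ω f₁ false) f₂ true ∈ (U ∩ (e ∩ Lᶜ))} = ∅ := by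
      ext ω; simp [e, L, U, hs1, hA']
    have e00 : {ω | Function.update (Function.update ω f₁ false) f₂ false ∈ (U ∩ (e ∩ Lᶜ))} = ∅ := by
      ext ω; simp [e, L, U, hs1]
    rw [e11, e10, e01, e00, prob_empty]; ring
  have PU : prob p U = p f₁ * p f₂ * (a + z) + p f₁ * (1 - p f₂) * (a + b)
      + (1 - p f₁) * p f₂ * (a + d) + (1 - p f₁) * (1 - p f₂) * (c + d) := by
    rw [prob_two_pin p hf]
    have e11 : {ω | Function.update (Function.update ω f₁ true) f₂ true ∈ U} = X₂ := by
      ext ω; simp [e, U, hs1, hX₂]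
    have e10 : {ω | Function.update (Function.update ω f₁ true) f₂ false ∈ U} = X₁ := by
      ext ω; simp [e, U, hs1, hX₁]
    have e01 : {ω | Function.update (Function.update ω f₁ false) f₂ true ∈ U} = (A' ∩ X₁) ∪ (A'ᶜ ∩ X₀) := by
      ext ω; simp [e, U, hs1, hA', hX₁, hX₀]
    have e00 : {ω | Function.update (Function.update ω f₁ false) f₂ false ∈ U} = X₀ := by
      ext ω; simp [e, U, hs1, hX₀]
    rw [e11, e10, e01, e00, hX2, hX1, hmix, hX0]
  have PB : prob p (eᶜ ∩ Lᶜ ∩ γ) = (1 - p f₁) * p f₂ * (1 - g) := by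
    rw [prob_two_pin p hf]
    have e11 : {ω | Function.update (Function.update ω f₁ true) f₂ true ∈ (eᶜ ∩ Lᶜ ∩ γ)} = ∅ := by
      ext ω; simp [e, L, γ, hs1]
    have e10 : {ω | Function.update (Function.update ω f₁ true) f₂ false ∈ (eᶜ ∩ Lᶜ ∩ γ)} = ∅ := by
      ext ω; simp [e, L, γ, hs1]
    have e01 : {ω | Function.update (Function.update ω f₁ false) f₂ true ∈ (eᶜ ∩ Lᶜ ∩ γ)} = A'ᶜ := by
      ext ω; simp [e, L, γ, hs1, hA']
    have e00 : {ω | Function.update (Function.update ω f₁ false) f₂ false ∈ (eᶜ ∩ Lᶜ ∩ γ)} = ∅ := by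
      ext ω; simp [e, L, γ, hs1, hA']
    rw [e11, e10, e01, e00, prob_empty, hAc]; ring
  have PD : prob p (eᶜ ∩ Lᶜ ∩ γᶜ) = (1 - p f₁) * (1 - p f₂) * (1 - g) := by
    rw [prob_two_pin p hf]
    have e11 : {ω | Function.update (Function.update ω f₁ true) f₂ true ∈ (eᶜ ∩ Lᶜ ∩ γᶜ)} = ∅ := by
      ext ω; simp [e, L, γ, hs1]
    have e10 : {ω | Function.update (Function.update ω f₁ true) f₂ false ∈ (eᶜ ∩ Lᶜ ∩ γᶜ)} = ∅ := by
      ext ω; simp [e, L, γ, hs1]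
    have e01 : {ω | Function.update (Function.update ω f₁ false) f₂ true ∈ (eᶜ ∩ Lᶜ ∩ γᶜ)} = ∅ := by
      ext ω; simp [e, L, γ, hs1]
    have e00 : {ω | Function.update (Function.update ω f₁ false) f₂ false ∈ (eᶜ ∩ Lᶜ ∩ γᶜ)} = A'ᶜ := by
      ext ω; simp [e, L, γ, hs1, hA']
    rw [e11, e10, e01, e00, prob_empty, hAc]; ring
  -- the probabilistic inputs (the Harris inequality enters through the explicit bound)
  have hzb : b ≤ z := prob_mono hp (Set.inter_subset_inter_left _ h12s)
  have hdb : d ≤ b := prob_mono hp (Set.inter_subset_inter_left _ h01)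
  have hca : c ≤ a := prob_mono hp (Set.inter_subset_inter_left _ (h01.trans h12s))
  have hg0 : 0 ≤ g := prob_nonneg hp _
  have hg1 : g ≤ 1 := prob_le_one hp _
  have hp1 := hp.nonneg f₁
  have hp1' := hp.le_one f₁
  have hp2 := hp.nonneg f₂
  have hp2' := hp.le_one f₂
  -- the algebra
  rw [PeL, PUeL, PenL, PUenL, PU, PB, PD]
  exact zc_a3_two_edge_alg (p f₁) (p f₂) g a z b c d hp1 hp1' hp2 hp2' hg0 hg1 hzb hdb hca

/-- **Theorem C, the sign**: under the hypotheses of `zc_a3_two_edge` and with `A'`, `X₂`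
increasing (one Harris inequality in `G − a₃`), (ZC) is nonnegative. -/
theorem zc_a3_two_edge_nonneg {p : E → R} (hp : IsProbVec p) {f₁ f₂ : E} (hf : f₁ ≠ f₂)
    {A' X₀ X₁ X₂ : Set (Config E)}
    (hA' : ∀ (ω : Config E) (b₁ b₂ : Bool),
      Function.update (Function.update ω f₁ b₁) f₂ b₂ ∈ A' ↔ ω ∈ A')
    (hX₀ : ∀ (ω : Config E) (b₁ b₂ : Bool),
      Function.update (Function.update ω f₁ b₁) f₂ b₂ ∈ X₀ ↔ ω ∈ X₀)
    (hX₁ : ∀ (ω : Config E) (b₁ b₂ : Bool),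
      Function.update (Function.update ω f₁ b₁) f₂ b₂ ∈ X₁ ↔ ω ∈ X₁)
    (hX₂ : ∀ (ω : Config E) (b₁ b₂ : Bool),
      Function.update (Function.update ω f₁ b₁) f₂ b₂ ∈ X₂ ↔ ω ∈ X₂)
    (hA'up : IsUpperSet A') (hX₂up : IsUpperSet X₂)
    (h12 : X₁ ∩ A' = X₂ ∩ A') (h01 : X₀ ⊆ X₁) (h12s : X₁ ⊆ X₂) :
    let e := openEdge f₁ ∪ (openEdge f₂ ∩ A')
    let L := A' ∪ (openEdge f₁ ∩ openEdge f₂)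
    let U := (openEdge f₁ ∩ openEdge f₂ ∩ X₂) ∪ (e ∩ (openEdge f₁ ∩ openEdge f₂)ᶜ ∩ X₁)
      ∪ (eᶜ ∩ X₀)
    let γ := openEdge f₂ ∪ (openEdge f₁ ∩ A')
    0 ≤ prob p (eᶜ ∩ Lᶜ ∩ γᶜ) * (prob p (U ∩ (e ∩ L)) - prob p U * prob p (e ∩ L))
      - prob p (eᶜ ∩ Lᶜ ∩ γ) * (prob p (U ∩ (e ∩ Lᶜ)) - prob p U * prob p (e ∩ Lᶜ)) := by
  intro e L U γ
  have h := zc_a3_two_edge hp hf hA' hX₀ hX₁ hX₂ h12 h01 h12s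
  simp only at h
  refine le_trans ?_ h
  have hHar : (prob p (X₂ ∩ A') + prob p (X₂ ∩ A'ᶜ)) * prob p A' ≤ prob p (X₂ ∩ A') := by
    have := prob_mul_prob_le_prob_inter hp hX₂up hA'up
    rwa [← prob_inter_add_prob_inter_compl p X₂ A'] at this
  have hzb : prob p (X₁ ∩ A'ᶜ) ≤ prob p (X₂ ∩ A'ᶜ) :=
    prob_mono hp (Set.inter_subset_inter_left _ h12s)
  have h1p : 0 ≤ 1 - p f₁ := sub_nonneg.2 (hp.le_one f₁)
  have h1q : 0 ≤ 1 - p f₂ := sub_nonneg.2 (hp.le_one f₂)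
  have h1g : 0 ≤ 1 - prob p A' := sub_nonneg.2 (prob_le_one hp _)
  have hπ₂ : 0 ≤ p f₁ + p f₂ - p f₁ * p f₂ := by
    have := mul_nonneg (hp.nonneg f₂) h1p; have := hp.nonneg f₁; nlinarith
  have hHar' : 0 ≤ (1 - prob p A') * prob p (X₂ ∩ A') - prob p A' * prob p (X₂ ∩ A'ᶜ) := by
    linarith
  exact mul_nonneg (mul_nonneg (mul_nonneg h1p h1q) h1g)
    (add_nonneg (mul_nonneg hπ₂ hHar')
      (mul_nonneg (mul_nonneg (hp.nonneg f₁) (hp.nonneg f₂)) (sub_nonneg.2 hzb)))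

end A3TwoEdgeTheorem

end Summit.Ventures.PercRepro2
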